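import Mathlib.MeasureTheory.Integral.MeanInequalities
import Mathlib.Analysis.SpecialFunctions.Integrals.Basic
import Literature.Analysis.FluidPDE.ChaeWolfDSSWeightedSerrin
import Literature.Analysis.FluidPDE.ChaeWolfDSSTimeAsymptotics
import Literature.Analysis.FluidPDE.ChaeWolfDSSDecayAnnulus
import Literature.Analysis.FluidPDE.ChaeWolfDSSDecayL3
import Literature.Analysis.FluidPDE.ClassicalTopPointCubic
import Literature.Analysis.FluidPDE.ClassicalLqRatePressure
import HarnessLib

/-!
# Chae–Wolf 2017, Theorem 1.1, for `3 ≤ q < 9`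

Analysis/FluidPDE proofs file (theorems only; no definitions, no named facts) on the discharge
path of the named fact `Literature.Analysis.FluidPDE.chaeWolf2017_dss_typeI_decay`
(`ChaeWolfRemovingDSS.lean`; D. Chae, J. Wolf, *Removing discretely self-similar singularities
for the 3D Navier–Stokes equations*, Comm. PDE 42 (2017) = arXiv:1610.09464, **Theorem 1.1**:
a `λ`-DSS classical solution on `ℝ³ × (−∞, 0)` with `u ∈ C((−∞,0); L^q)`, `3 ≤ q < ∞`, obeys
`|u(x,t)| ≤ C/(|x| + √(−t))`). This file PROVES the theorem in the range `3 ≤ q < 9`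
(`chaeWolf2017_dss_typeI_decay_of_lt_nine`), assembling the accepted pieces of the printed proof:

* Step 1, (2.4a): `‖u(t)‖_q ≤ λ^{1−3/q}(−t)^{(3−q)/(2q)} N` (`ChaeWolfDSSTimeAsymptotics`);
* Step 2, (2.4c): the local energy classes and the `L^{3/2}` pressure class up to `t = 0` on every
  cylinder `Q_ρ(0, x₀)`, here for the rate `κ = (q−3)/(2q)` with `3κ < 1 ⇔ q < 9`
  (`ClassicalLqRateEnergy`, `ClassicalLqRatePressure`);
* Step 3, (2.5): the weighted Serrin estimate
  `∫_{−∞}^0 ∫_{1≤|x|<λ} |u|^q (−t)^{(q−5)/2} < ∞` (`ChaeWolfDSSWeightedSerrin`);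
* Step 4: **`lim_{r→0} r⁻² ∫∫_{Q(z₀,r)} |u|³ = 0`** at every `z₀ = (x₀, 0)`, `x₀ ≠ 0` — proved here
  (`tendsto_cknC_zero_of_weighted_lt_top`) by Hölder's inequality against the weight of Step 3,
  `r⁻² ∫∫_{Q_r} |u|³ ≤ C_q (∫∫_{Q_r} |u|^q (−t)^{(q−5)/2})^{3/q}` (the bookkeeping of the exponents
  gives exactly `r⁰`; the time factor `∫₀^{r²} τ^{−3(q−5)/(2(q−3))} dτ` is finite iff `q < 9`), and
  the absolute continuity of the integral — then "thanks to [gus] … `z₀` is a regular point"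
  (`exists_bound_near_top_of_classical_Iio`, `ClassicalTopPointCubic`);
* Step 5: local bounds at the top points of one annulus + DSS ⇒ the Type I bound
  (`IsClassicalNSSolutionOn.exists_hasTypeIDecay_of_local_bounds`, `ChaeWolfDSSDecayAnnulus`).

The case `q = 3` is the accepted `chaeWolf2017_dss_typeI_decay_three` (`ChaeWolfDSSDecayL3`); the
case `q ≥ 9` (where the printed proof absorbs the terms `II, III` of (2.4f) and uses Wolf's
pressure-free ε-regularity criterion) is not covered by this file.

## References

* D. Chae, J. Wolf, arXiv:1610.09464, Thm. 1.1 and §2 (p. 3, 5–7). [ChaeWolf2017RemovingDSS]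
* S. Gustafson, K. Kang, T.-P. Tsai, Comm. Math. Phys. 273 (2007), Thm. 1.1. [GustafsonKangTsai2007]
-/

noncomputable section

open MeasureTheory TopologicalSpace Set Function Filter Metric
open _root_.Topology
open scoped ENNReal NNReal

namespace Literature.Analysis.FluidPDE

namespace ChaeWolfDecay

variable {u : ℝ → EuclideanSpace ℝ (Fin 3) → EuclideanSpace ℝ (Fin 3)}

/-! ### The `L^q` norm on the period strip -/

/-- Continuity in `L^p` gives continuity of the `L^p` norm (within `(−∞, 0)`), `1 ≤ p`. [folklore] -/
theorem continuousWithinAt_eLpNorm_of_exponent {p : ℝ≥0∞} (hp : 1 ≤ p)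
    (hLp : ∀ t < 0, MemLp (u t) p volume)
    (hcont : ∀ t₀ < 0, Tendsto (fun t => eLpNorm (u t - u t₀) p volume) (𝓝[Iio 0] t₀) (𝓝 0))
    {t₀ : ℝ} (ht₀ : t₀ < 0) :
    ContinuousWithinAt (fun t => eLpNorm (u t) p volume) (Iio 0) t₀ := by
  set N : ℝ → ℝ≥0∞ := fun t => eLpNorm (u t) p volume with hN
  set e : ℝ → ℝ≥0∞ := fun t => eLpNorm (u t - u t₀) p volume with he
  have hm : ∀ t < 0, AEStronglyMeasurable (u t) volume := fun t ht => (hLp t ht).1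
  have hev : ∀ᶠ t in 𝓝[Iio 0] t₀, t < 0 := eventually_mem_nhdsWithin
  have hup : ∀ᶠ t in 𝓝[Iio 0] t₀, N t ≤ N t₀ + e t := by
    filter_upwards [hev] with t ht
    have eq : u t = (u t - u t₀) + u t₀ := by abel
    calc N t = eLpNorm ((u t - u t₀) + u t₀) p volume := by rw [hN]; exact congrArg (eLpNorm · p volume) eq
      _ ≤ e t + N t₀ := eLpNorm_add_le ((hm t ht).sub (hm t₀ ht₀)) (hm t₀ ht₀) hp
      _ = N t₀ + e t := add_comm _ _
  have hlow : ∀ᶠ t in 𝓝[Iio 0] t₀, N t₀ - e t ≤ N t := by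
    filter_upwards [hev] with t ht
    have eq : u t₀ = (u t₀ - u t) + u t := by abel
    have h1 : N t₀ ≤ e t + N t := by
      calc N t₀ = eLpNorm ((u t₀ - u t) + u t) p volume := by
            rw [hN]; exact congrArg (eLpNorm · p volume) eq
        _ ≤ eLpNorm (u t₀ - u t) p volume + N t :=
            eLpNorm_add_le ((hm t₀ ht₀).sub (hm t ht)) (hm t ht) hp
        _ = e t + N t := by rw [he, eLpNorm_sub_comm]
    exact tsub_le_iff_right.2 (by rwa [add_comm] at h1)
  have hfin : N t₀ ≠ ⊤ := (hLp t₀ ht₀).eLpNorm_ne_top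
  have hlim_up : Tendsto (fun t => N t₀ + e t) (𝓝[Iio 0] t₀) (𝓝 (N t₀)) := by
    have := (tendsto_const_nhds (x := N t₀)).add (hcont t₀ ht₀)
    rwa [add_zero] at this
  have hlim_low : Tendsto (fun t => N t₀ - e t) (𝓝[Iio 0] t₀) (𝓝 (N t₀)) := by
    have := ENNReal.Tendsto.sub (tendsto_const_nhds (x := N t₀)) (hcont t₀ ht₀) (Or.inl hfin)
    rwa [tsub_zero] at this
  exact tendsto_of_tendsto_of_tendsto_of_le_of_le' hlim_low hlim_up hlow hup

/-- **The `L^p` norm is bounded on a compact time strip** `[a, b] ⊆ (−∞, 0)` for a field in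
`C((−∞,0); L^p)`. [folklore] -/
theorem exists_eLpNorm_le_on_strip {p : ℝ≥0∞} (hp : 1 ≤ p)
    (hLp : ∀ t < 0, MemLp (u t) p volume)
    (hcont : ∀ t₀ < 0, Tendsto (fun t => eLpNorm (u t - u t₀) p volume) (𝓝[Iio 0] t₀) (𝓝 0))
    {a b : ℝ} (hb : b < 0) :
    ∃ N : ℝ≥0, ∀ s ∈ Icc a b, eLpNorm (u s) p volume ≤ N := by
  set K : Set ℝ := Icc a b with hK
  have hKneg : ∀ s ∈ K, s < 0 := fun s hs => lt_of_le_of_lt hs.2 hb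
  have hNc : ContinuousOn (fun s => eLpNorm (u s) p volume) K := fun s hs =>
    (continuousWithinAt_eLpNorm_of_exponent hp hLp hcont (hKneg s hs)).mono fun r hr => hKneg r hr
  rcases K.eq_empty_or_nonempty with hKe | hKne
  · exact ⟨0, fun s hs => by rw [hKe] at hs; exact hs.elim⟩
  obtain ⟨s₀, hs₀, hmax⟩ := isCompact_Icc.exists_isMaxOn hKne hNc
  have hfin : eLpNorm (u s₀) p volume < ⊤ := (hLp s₀ (hKneg s₀ hs₀)).eLpNorm_lt_top
  refine ⟨(eLpNorm (u s₀) p volume).toNNReal, fun s hs => ?_⟩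
  rw [ENNReal.coe_toNNReal hfin.ne]
  exact hmax hs

/-- **Finiteness of `∫∫_{[a,b]×ℝ³} |u|^q`** from a bound `‖u(s)‖_{L^q} ≤ N` on the strip and joint
continuity (Tonelli). [folklore] -/
theorem lintegral_strip_lt_top (hcont : ContinuousOn (uncurry u) (Iio 0 ×ˢ univ)) {q : ℝ}
    (hq : 0 < q) {a b : ℝ} (hb : b < 0) {N : ℝ≥0}
    (hN : ∀ s ∈ Icc a b, eLpNorm (u s) (ENNReal.ofReal q) volume ≤ N) :
    ∫⁻ z in Ioc a b ×ˢ (univ : Set (EuclideanSpace ℝ (Fin 3))), ‖u z.1 z.2‖ₑ ^ q < ⊤ := by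
  have hvol : (volume : Measure (ℝ × (EuclideanSpace ℝ (Fin 3)))) =
      (volume : Measure ℝ).prod (volume : Measure (EuclideanSpace ℝ (Fin 3))) := rfl
  have hsub : Ioc a b ×ˢ (univ : Set (EuclideanSpace ℝ (Fin 3))) ⊆ Iio 0 ×ˢ univ :=
    prod_mono (fun s hs => lt_of_le_of_lt hs.2 hb) subset_rfl
  set F : ℝ × (EuclideanSpace ℝ (Fin 3)) → ℝ≥0∞ := fun z => ‖u z.1 z.2‖ₑ ^ q with hF
  have hFm : AEMeasurable F ((volume.restrict (Ioc a b)).prod (volume.restrict univ)) := by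
    rw [Measure.prod_restrict]
    have h1 : AEStronglyMeasurable (uncurry u) (volume.restrict (Ioc a b ×ˢ univ)) :=
      (hcont.mono hsub).aestronglyMeasurable (measurableSet_Ioc.prod MeasurableSet.univ)
    exact (h1.enorm.pow_const q)
  rw [hvol, ← Measure.prod_restrict, lintegral_prod _ hFm]
  have hq0 : ENNReal.ofReal q ≠ 0 := (ENNReal.ofReal_pos.2 hq).ne'
  have hinner : ∀ s ∈ Ioc a b, ∫⁻ x in (univ : Set (EuclideanSpace ℝ (Fin 3))), F (s, x) ≤ (N : ℝ≥0∞) ^ q := by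
    intro s hs
    rw [Measure.restrict_univ]
    have e : ∫⁻ x, F (s, x) = eLpNorm (u s) (ENNReal.ofReal q) volume ^ q := by
      have h1 := lintegral_rpow_enorm_eq_rpow_eLpNorm' (f := u s) (μ := volume) hq
      rw [eLpNorm_eq_eLpNorm' hq0 ENNReal.ofReal_ne_top, ENNReal.toReal_ofReal hq.le]
      exact h1
    rw [e]
    exact ENNReal.rpow_le_rpow (hN s (Ioc_subset_Icc_self hs)) hq.le
  calc ∫⁻ s in Ioc a b, ∫⁻ x in (univ : Set (EuclideanSpace ℝ (Fin 3))), F (s, x)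
      ≤ ∫⁻ _ in Ioc a b, (N : ℝ≥0∞) ^ q := setLIntegral_mono' measurableSet_Ioc fun s hs => hinner s hs
    _ = (N : ℝ≥0∞) ^ q * volume (Ioc a b) := setLIntegral_const _ _
    _ < ⊤ := ENNReal.mul_lt_top (ENNReal.rpow_lt_top_of_nonneg hq.le ENNReal.coe_ne_top)
        measure_Ioc_lt_top

/-! ### Step 4: `r⁻² ∫∫_{Q_r} |u|³ → 0` from the weighted Serrin estimate (`3 < q < 9`) -/

section Cubic

/-- The time factor: `∫⁻_{(−r²,0)} (−t)^{−β} dt = (r²)^{1−β}/(1−β)` for `β < 1`, `r > 0`. [folklore] -/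
theorem lintegral_Ioo_rpow_neg {β : ℝ} (hβ : β < 1) {r : ℝ} (hr : 0 < r) :
    ∫⁻ t in Ioo (0 - r ^ 2) (0 : ℝ), ENNReal.ofReal (-t) ^ (-β) =
      ENNReal.ofReal ((r ^ 2) ^ (1 - β) / (1 - β)) := by
  rw [zero_sub]
  have hr2 : 0 < r ^ 2 := by positivity
  have e1 : ∫⁻ t in Ioo (-r ^ 2) (0 : ℝ), ENNReal.ofReal (-t) ^ (-β) =
      ∫⁻ t in Ioo (-r ^ 2) (0 : ℝ), ENNReal.ofReal ((-t) ^ (-β)) :=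
    setLIntegral_congr_fun measurableSet_Ioo fun t ht =>
      ENNReal.ofReal_rpow_of_pos (by linarith [ht.2])
  -- integrability of `(-t)^{-β}` on `(−r², 0)`
  have hint : IntegrableOn (fun t : ℝ => (-t) ^ (-β)) (Ioo (-r ^ 2) 0) volume := by
    have h1 : IntervalIntegrable (fun x : ℝ => x ^ (-β)) volume (-(-r ^ 2)) 0 :=
      intervalIntegral.intervalIntegrable_rpow' (by linarith)
    have h2 := h1.comp_sub_left 0
    simp only [zero_sub, sub_zero, neg_neg] at h2
    exact h2.1.mono_set Ioo_subset_Ioc_self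
  rw [e1, ← ofReal_integral_eq_lintegral_ofReal hint
    ((ae_restrict_iff' measurableSet_Ioo).2 (ae_of_all _ fun t ht =>
      Real.rpow_nonneg (by linarith [ht.2]) _))]
  congr 1
  rw [← integral_Ioc_eq_integral_Ioo, ← intervalIntegral.integral_of_le (by linarith),
    show (∫ t in (-r ^ 2)..0, (-t) ^ (-β)) = ∫ t in (-r ^ 2)..0, (fun x : ℝ => x ^ (-β)) (-t)
      from rfl,
    intervalIntegral.integral_comp_neg (fun x : ℝ => x ^ (-β)), neg_zero, neg_neg,
    integral_rpow (Or.inl (by linarith))]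
  have h1β : -β + 1 = 1 - β := by ring
  rw [h1β, Real.zero_rpow (by linarith), sub_zero]

/-- The exponent bookkeeping of Step 4: with `β = 3(q−5)/(2(q−3))`,
`(r³ (r²)^{1−β})^{(q−3)/q} = r²` (`q > 3`, `r > 0`). [folklore] -/
theorem cubic_exponent_identity {q : ℝ} (hq : 3 < q) {r : ℝ} (hr : 0 < r) :
    (r ^ 3 * (r ^ 2) ^ (1 - 3 * (q - 5) / (2 * (q - 3)))) ^ ((q - 3) / q) = r ^ 2 := by
  set β : ℝ := 3 * (q - 5) / (2 * (q - 3)) with hβ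
  have hq0 : q ≠ 0 := by linarith
  have hq3 : q - 3 ≠ 0 := by linarith
  have e1 : r ^ 3 * (r ^ 2) ^ (1 - β) = r ^ (5 - 2 * β) := by
    rw [← Real.rpow_natCast r 3, ← Real.rpow_natCast r 2, ← Real.rpow_mul hr.le,
      ← Real.rpow_add hr]
    congr 1; push_cast; ring
  rw [e1, ← Real.rpow_mul hr.le]
  have e2 : (5 - 2 * β) * ((q - 3) / q) = 2 := by
    rw [hβ]; field_simp; ring
  rw [e2]
  exact_mod_cast Real.rpow_natCast r 2

/-- **Hölder's inequality for the cubic functional against the Step-3 weight.** For `3 < q < 9`,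
`u` jointly continuous below `t = 0` and a cylinder `Q_r(0, x₀)`:
`∫∫_{Q_r(0,x₀)} |u|³ ≤ (∫∫_{Q_r(0,x₀)} |u|^q (−t)^{(q−5)/2})^{3/q} · K_q r²`, with
`K_q = (|B₁|/(1−β))^{(q−3)/q}`, `β = 3(q−5)/(2(q−3)) < 1`. [cite: ChaeWolf2017RemovingDSS, §2 Step 4 (arXiv p. 6–7); GustafsonKangTsai2007 Thm. 1.1] -/
theorem lintegral_cube_le_weighted (hcont : ContinuousOn (uncurry u) (Iio 0 ×ˢ univ))
    {q : ℝ} (hq3 : 3 < q) (hq9 : q < 9) (x₀ : EuclideanSpace ℝ (Fin 3)) {r : ℝ} (hr : 0 < r) :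
    ∫⁻ z in parabolicCylinder r ((0 : ℝ), x₀), ‖u z.1 z.2‖ₑ ^ (3 : ℕ) ≤
      (∫⁻ z in parabolicCylinder r ((0 : ℝ), x₀),
          ‖u z.1 z.2‖ₑ ^ q * ENNReal.ofReal ((-z.1) ^ ((q - 5) / 2))) ^ (3 / q) *
        ENNReal.ofReal ((((volume : Measure (EuclideanSpace ℝ (Fin 3))) (ball 0 1)).toReal /
          (1 - 3 * (q - 5) / (2 * (q - 3)))) ^ ((q - 3) / q) * r ^ 2) := by
  -- exponents
  set β : ℝ := 3 * (q - 5) / (2 * (q - 3)) with hβ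
  set a : ℝ := 3 * (q - 5) / (2 * q) with ha
  have hq0 : 0 < q := by linarith
  have hq3' : 0 < q - 3 := by linarith
  have hβ1 : β < 1 := by
    rw [hβ, div_lt_one (by positivity)]; linarith
  have hPP : (q / 3).HolderConjugate (q / (q - 3)) := by
    refine Real.holderConjugate_iff.2 ⟨by rw [lt_div_iff₀ (by norm_num : (0:ℝ) < 3)]; linarith, ?_⟩
    field_simp; ring
  set Q : Set (ℝ × EuclideanSpace ℝ (Fin 3)) := parabolicCylinder r ((0 : ℝ), x₀) with hQ
  have hQm : MeasurableSet Q := (isOpen_parabolicCylinder _ _).measurableSet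
  have hQsub : Q ⊆ Iio 0 ×ˢ univ := fun z hz => by
    rw [hQ, mem_parabolicCylinder] at hz
    exact ⟨(hz.1.2 : z.1 < 0), mem_univ _⟩
  have hneg : ∀ z ∈ Q, 0 < -z.1 := fun z hz => by
    have := (hQsub hz).1; simp only [mem_Iio] at this; linarith
  set ν : Measure (ℝ × EuclideanSpace ℝ (Fin 3)) := volume.restrict Q with hν
  -- the weight and the two Hölder factors
  set W : ℝ × EuclideanSpace ℝ (Fin 3) → ℝ≥0∞ := fun z => ENNReal.ofReal (-z.1) with hW
  have hWm : Measurable W := ENNReal.measurable_ofReal.comp (measurable_fst.neg)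
  have hW0 : ∀ z ∈ Q, W z ≠ 0 := fun z hz => (ENNReal.ofReal_pos.2 (hneg z hz)).ne'
  have hWt : ∀ z, W z ≠ ⊤ := fun z => ENNReal.ofReal_ne_top
  set f : ℝ × EuclideanSpace ℝ (Fin 3) → ℝ≥0∞ := fun z => ‖u z.1 z.2‖ₑ ^ (3 : ℕ) * W z ^ a with hf
  set g : ℝ × EuclideanSpace ℝ (Fin 3) → ℝ≥0∞ := fun z => W z ^ (-a) with hg
  have hum : AEMeasurable (fun z : ℝ × EuclideanSpace ℝ (Fin 3) => ‖u z.1 z.2‖ₑ ^ (3 : ℕ)) ν := by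
    have h1 : AEStronglyMeasurable (uncurry u) ν := (hcont.mono hQsub).aestronglyMeasurable hQm
    exact h1.enorm.pow_const _
  have hfm : AEMeasurable f ν := hum.mul (hWm.pow_const a).aemeasurable
  have hgm : AEMeasurable g ν := (hWm.pow_const (-a)).aemeasurable
  -- Hölder
  have hH := ENNReal.lintegral_mul_le_Lp_mul_Lq ν hPP hfm hgm
  -- identify the three integrals
  have e_fg : ∫⁻ z, (f * g) z ∂ν = ∫⁻ z in Q, ‖u z.1 z.2‖ₑ ^ (3 : ℕ) := by
    refine setLIntegral_congr_fun hQm fun z hz => ?_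
    show ‖u z.1 z.2‖ₑ ^ (3 : ℕ) * W z ^ a * W z ^ (-a) = ‖u z.1 z.2‖ₑ ^ (3 : ℕ)
    rw [mul_assoc, ← ENNReal.rpow_add _ _ (hW0 z hz) (hWt z), add_neg_cancel, ENNReal.rpow_zero, mul_one]
  have e_f : ∫⁻ z, f z ^ (q / 3) ∂ν = ∫⁻ z in Q, ‖u z.1 z.2‖ₑ ^ q * ENNReal.ofReal ((-z.1) ^ ((q - 5) / 2)) := by
    refine setLIntegral_congr_fun hQm fun z hz => ?_
    show (‖u z.1 z.2‖ₑ ^ (3 : ℕ) * W z ^ a) ^ (q / 3) = _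
    rw [ENNReal.mul_rpow_of_nonneg _ _ (by positivity), ← ENNReal.rpow_natCast, ← ENNReal.rpow_mul,
      ← ENNReal.rpow_mul, hW, ENNReal.ofReal_rpow_of_pos (hneg z hz)]
    have e3 : ((3 : ℕ) : ℝ) * (q / 3) = q := by rw [Nat.cast_ofNat]; ring
    have e4 : a * (q / 3) = (q - 5) / 2 := by rw [ha]; field_simp
    rw [e3, e4]
  have e_g : ∫⁻ z, g z ^ (q / (q - 3)) ∂ν = ∫⁻ z in Q, W z ^ (-β) := by
    refine setLIntegral_congr_fun hQm fun z _ => ?_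
    show (W z ^ (-a)) ^ (q / (q - 3)) = W z ^ (-β)
    rw [← ENNReal.rpow_mul]
    congr 1
    rw [ha, hβ]; field_simp
  -- the time factor
  have e_w : ∫⁻ z in Q, W z ^ (-β) = volume (ball x₀ r) * ENNReal.ofReal ((r ^ 2) ^ (1 - β) / (1 - β)) := by
    have hvol : (volume : Measure (ℝ × (EuclideanSpace ℝ (Fin 3)))) =
        (volume : Measure ℝ).prod (volume : Measure (EuclideanSpace ℝ (Fin 3))) := rfl
    have hm : AEMeasurable (fun z : ℝ × EuclideanSpace ℝ (Fin 3) => W z ^ (-β))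
        ((volume.restrict (Ioo (0 - r ^ 2) 0)).prod (volume.restrict (ball x₀ r))) :=
      (hWm.pow_const (-β)).aemeasurable
    rw [hQ, parabolicCylinder, hvol, ← Measure.prod_restrict, lintegral_prod _ hm]
    simp only [hW]
    have hmeas' : Measurable fun x : ℝ => ENNReal.ofReal (-x) ^ (-β) :=
      (ENNReal.measurable_ofReal.comp measurable_neg).pow_const (-β)
    rw [show (fun x : ℝ => ∫⁻ _ in ball x₀ r, ENNReal.ofReal (-x) ^ (-β) ∂volume) =
        fun x : ℝ => ENNReal.ofReal (-x) ^ (-β) * volume (ball x₀ r) from by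
          funext x; rw [setLIntegral_const],
      lintegral_mul_const _ hmeas', lintegral_Ioo_rpow_neg hβ1 hr, mul_comm]
  have e_K : (volume (ball x₀ r) * ENNReal.ofReal ((r ^ 2) ^ (1 - β) / (1 - β))) ^ ((q - 3) / q) =
      ENNReal.ofReal ((((volume : Measure (EuclideanSpace ℝ (Fin 3))) (ball 0 1)).toReal /
        (1 - β)) ^ ((q - 3) / q) * r ^ 2) := by
    have hV : volume (ball x₀ r) = ENNReal.ofReal (r ^ 3 * ((volume : Measure (EuclideanSpace ℝ (Fin 3))) (ball 0 1)).toReal) := by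
      rw [Measure.addHaar_ball_of_pos volume x₀ hr, finrank_euclideanSpace_fin,
        ENNReal.ofReal_mul (by positivity), ENNReal.ofReal_toReal (measure_ball_lt_top).ne]
    have h1β : 0 < 1 - β := by linarith
    set V₁ : ℝ := ((volume : Measure (EuclideanSpace ℝ (Fin 3))) (ball 0 1)).toReal with hV₁
    have hV₁0 : 0 ≤ V₁ := ENNReal.toReal_nonneg
    rw [hV, ← ENNReal.ofReal_mul (by positivity),
      ENNReal.ofReal_rpow_of_nonneg (by positivity) (by positivity)]
    congr 1
    rw [show r ^ 3 * V₁ * ((r ^ 2) ^ (1 - β) / (1 - β)) = (V₁ / (1 - β)) * (r ^ 3 * (r ^ 2) ^ (1 - β)) by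
      field_simp, Real.mul_rpow (by positivity) (by positivity), hβ, cubic_exponent_identity hq3 hr]
  -- assemble
  have h13 : 1 / (q / 3) = 3 / q := by field_simp
  have h23 : 1 / (q / (q - 3)) = (q - 3) / q := by field_simp
  rw [e_fg, e_f, e_g, h13, h23, e_w, e_K] at hH
  exact hH

/-- **Step 4: `r⁻² ∫∫_{Q(z₀,r)} |u|³ → 0`** at a top point `z₀ = (x₀, 0)` whose spatial
neighbourhood `B(x₀, ρ)` lies in a region `D` where the weighted Serrin integral of Step 3 is
finite, `∫_{−∞}^0 ∫_D |u|^q (−t)^{(q−5)/2} < ∞` (`3 < q < 9`): by Hölder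
`C(r) ≤ K_q (∫∫_{Q_r} |u|^q (−t)^{(q−5)/2})^{3/q}` and the right-hand side tends to `0` with
`|Q_r|` (absolute continuity of the integral). [cite: ChaeWolf2017RemovingDSS, §2 Step 4, (2.9)–(2.18) and "lim_{r→0} r⁻²∫_{Q(z₀,r)}|u|³ = 0" (arXiv p. 6–7)] -/
theorem tendsto_cknC_zero_of_weighted_lt_top (hcont : ContinuousOn (uncurry u) (Iio 0 ×ˢ univ))
    {D : Set (EuclideanSpace ℝ (Fin 3))} (hD : MeasurableSet D) {q : ℝ} (hq3 : 3 < q) (hq9 : q < 9)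
    (hfin : ∫⁻ z in Iio (0 : ℝ) ×ˢ D, ‖u z.1 z.2‖ₑ ^ q * ENNReal.ofReal ((-z.1) ^ ((q - 5) / 2)) < ⊤)
    (x₀ : EuclideanSpace ℝ (Fin 3)) {ρ : ℝ} (hρ : 0 < ρ) (hball : ball x₀ ρ ⊆ D) :
    Tendsto (fun r => cknC r ((0 : ℝ), x₀) u) (𝓝[>] 0) (𝓝 0) := by
  have hq0 : 0 < q := by linarith
  set F : ℝ × EuclideanSpace ℝ (Fin 3) → ℝ≥0∞ := fun z =>
    ‖u z.1 z.2‖ₑ ^ q * ENNReal.ofReal ((-z.1) ^ ((q - 5) / 2)) with hF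
  set K : ℝ := ((((volume : Measure (EuclideanSpace ℝ (Fin 3))) (ball 0 1)).toReal /
    (1 - 3 * (q - 5) / (2 * (q - 3)))) ^ ((q - 3) / q)) with hK
  have h1β : 0 < 1 - 3 * (q - 5) / (2 * (q - 3)) := by
    have : 3 * (q - 5) / (2 * (q - 3)) < 1 := by
      rw [div_lt_one (by nlinarith)]; linarith
    linarith
  have hK0 : 0 ≤ K := Real.rpow_nonneg (div_nonneg ENNReal.toReal_nonneg h1β.le) _
  set μ : Measure (ℝ × EuclideanSpace ℝ (Fin 3)) := volume.restrict (Iio (0 : ℝ) ×ˢ D) with hμ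
  have hSm : MeasurableSet (Iio (0 : ℝ) ×ˢ D) := measurableSet_Iio.prod hD
  -- cylinders of radius `≤ ρ` lie in `(−∞,0) × D`
  have hsub : ∀ r ∈ Ioc 0 ρ, parabolicCylinder r ((0 : ℝ), x₀) ⊆ Iio (0 : ℝ) ×ˢ D := by
    intro r hr z hz
    rw [mem_parabolicCylinder] at hz
    exact ⟨(hz.1.2 : z.1 < 0), hball ((ball_subset_ball hr.2) (by simpa using hz.2))⟩
  -- `I(r) = ∫∫_{Q_r} F → 0`
  have hvol_tend : Tendsto (fun r : ℝ => μ (parabolicCylinder r ((0 : ℝ), x₀))) (𝓝[>] 0) (𝓝 0) := by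
    have hle : ∀ r ∈ Ioi (0 : ℝ), μ (parabolicCylinder r ((0 : ℝ), x₀)) ≤
        ENNReal.ofReal (r ^ 2) * volume (ball x₀ r) := by
      intro r hr
      calc μ (parabolicCylinder r ((0 : ℝ), x₀)) ≤ volume (parabolicCylinder r ((0 : ℝ), x₀)) :=
            Measure.restrict_apply_le _ _
        _ = volume (Ioo ((0 : ℝ) - r ^ 2) 0) * volume (ball x₀ r) := by
            rw [parabolicCylinder, Measure.volume_eq_prod, Measure.prod_prod]
        _ = ENNReal.ofReal (r ^ 2) * volume (ball x₀ r) := by rw [Real.volume_Ioo]; ring_nf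
    have h0 : Tendsto (fun r : ℝ => ENNReal.ofReal (r ^ 2) * volume (ball x₀ r)) (𝓝[>] 0) (𝓝 0) := by
      have h1 : Tendsto (fun r : ℝ => ENNReal.ofReal (r ^ 2)) (𝓝[>] 0) (𝓝 0) := by
        have : Tendsto (fun r : ℝ => r ^ 2) (𝓝[>] (0:ℝ)) (𝓝 0) := by
          have h := tendsto_nhdsWithin_of_tendsto_nhds (s := Ioi (0:ℝ)) ((continuous_pow 2).tendsto (0:ℝ))
          simpa using h
        simpa using ENNReal.tendsto_ofReal this
      have h2 : ∀ r ∈ Ioo (0 : ℝ) ρ, volume (ball x₀ r) ≤ volume (ball x₀ ρ) := fun r hr =>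
        measure_mono (ball_subset_ball hr.2.le)
      have hfinρ : volume (ball x₀ ρ) ≠ ⊤ := (measure_ball_lt_top).ne
      have h3 : Tendsto (fun r : ℝ => ENNReal.ofReal (r ^ 2) * volume (ball x₀ ρ)) (𝓝[>] 0) (𝓝 0) := by
        have := ENNReal.Tendsto.mul_const h1 (Or.inr hfinρ)
        rwa [zero_mul] at this
      refine tendsto_of_tendsto_of_tendsto_of_le_of_le' tendsto_const_nhds h3
        (Eventually.of_forall fun r => zero_le) ?_
      filter_upwards [Ioo_mem_nhdsGT hρ] with r hr
      exact mul_le_mul' le_rfl (h2 r hr)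
    refine tendsto_of_tendsto_of_tendsto_of_le_of_le' tendsto_const_nhds h0
      (Eventually.of_forall fun r => zero_le) ?_
    filter_upwards [self_mem_nhdsWithin] with r hr using hle r hr
  have hI : Tendsto (fun r : ℝ => ∫⁻ z in parabolicCylinder r ((0 : ℝ), x₀), F z ∂μ) (𝓝[>] 0) (𝓝 0) :=
    tendsto_setLIntegral_zero (by rw [hμ]; exact hfin.ne) hvol_tend
  have hI' : Tendsto (fun r : ℝ => ∫⁻ z in parabolicCylinder r ((0 : ℝ), x₀), F z) (𝓝[>] 0) (𝓝 0) := by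
    refine hI.congr' ?_
    filter_upwards [Ioc_mem_nhdsGT hρ] with r hr
    rw [hμ, Measure.restrict_restrict (isOpen_parabolicCylinder _ _).measurableSet,
      inter_eq_left.2 (hsub r hr)]
  -- the bound `C(r) ≤ K I(r)^{3/q}`
  have hbound : ∀ r ∈ Ioc 0 ρ, cknC r ((0 : ℝ), x₀) u ≤
      ENNReal.ofReal K * (∫⁻ z in parabolicCylinder r ((0 : ℝ), x₀), F z) ^ (3 / q) := by
    intro r hr
    have key := lintegral_cube_le_weighted hcont hq3 hq9 x₀ hr.1
    rw [cknC]
    have hr0 : ENNReal.ofReal r ≠ 0 := (ENNReal.ofReal_pos.2 hr.1).ne'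
    calc (ENNReal.ofReal r ^ 2)⁻¹ * ∫⁻ z in parabolicCylinder r ((0 : ℝ), x₀), ‖u z.1 z.2‖ₑ ^ (3 : ℕ)
        ≤ (ENNReal.ofReal r ^ 2)⁻¹ * ((∫⁻ z in parabolicCylinder r ((0 : ℝ), x₀), F z) ^ (3 / q) *
            ENNReal.ofReal (K * r ^ 2)) := mul_le_mul' le_rfl key
      _ = ENNReal.ofReal K * (∫⁻ z in parabolicCylinder r ((0 : ℝ), x₀), F z) ^ (3 / q) := by
          rw [ENNReal.ofReal_mul hK0, ENNReal.ofReal_pow hr.1.le]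
          have hcancel : (ENNReal.ofReal r ^ 2)⁻¹ * ENNReal.ofReal r ^ 2 = 1 :=
            ENNReal.inv_mul_cancel (pow_ne_zero _ hr0) (ENNReal.pow_ne_top ENNReal.ofReal_ne_top)
          calc (ENNReal.ofReal r ^ 2)⁻¹ * ((∫⁻ z in parabolicCylinder r ((0 : ℝ), x₀), F z) ^ (3 / q) *
                (ENNReal.ofReal K * ENNReal.ofReal r ^ 2))
              = ((ENNReal.ofReal r ^ 2)⁻¹ * ENNReal.ofReal r ^ 2) * (ENNReal.ofReal K *
                  (∫⁻ z in parabolicCylinder r ((0 : ℝ), x₀), F z) ^ (3 / q)) := by ring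
            _ = _ := by rw [hcancel, one_mul]
  -- conclude
  have hlim : Tendsto (fun r : ℝ => ENNReal.ofReal K *
      (∫⁻ z in parabolicCylinder r ((0 : ℝ), x₀), F z) ^ (3 / q)) (𝓝[>] 0) (𝓝 0) := by
    have h1 : Tendsto (fun r : ℝ => (∫⁻ z in parabolicCylinder r ((0 : ℝ), x₀), F z) ^ (3 / q))
        (𝓝[>] 0) (𝓝 0) := by
      have := ((ENNReal.continuous_rpow_const (y := 3 / q)).tendsto 0).comp hI'
      rwa [ENNReal.zero_rpow_of_pos (by positivity)] at this
    have := ENNReal.Tendsto.const_mul (a := ENNReal.ofReal K) h1 (Or.inr ENNReal.ofReal_ne_top)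
    rwa [mul_zero] at this
  refine tendsto_of_tendsto_of_tendsto_of_le_of_le' tendsto_const_nhds hlim
    (Eventually.of_forall fun r => zero_le) ?_
  filter_upwards [Ioc_mem_nhdsGT hρ] with r hr using hbound r hr

end Cubic

/-! ### The assembly for `3 < q < 9` -/

/-- **Chae–Wolf 2017, Theorem 1.1, for `3 < q < 9`** (internal form). [cite: ChaeWolf2017RemovingDSS, Thm. 1.1 (arXiv p. 3) and its proof §2 (p. 5–7)] -/
theorem exists_hasTypeIDecay_of_memLp_of_lt_nine {c : ℝ} (hc : 1 < c) {q : ℝ} (hq3 : 3 < q) (hq9 : q < 9)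
    {p : ℝ → EuclideanSpace ℝ (Fin 3) → ℝ} (hsol : IsClassicalNSSolutionOn (Iio 0) 1 0 u p)
    (hLq : ∀ t < 0, MemLp (u t) (ENNReal.ofReal q) volume)
    (hcont : ∀ t₀ < 0, Tendsto (fun t => eLpNorm (u t - u t₀) (ENNReal.ofReal q) volume)
      (𝓝[Iio 0] t₀) (𝓝 0))
    (hdss : IsDiscretelySelfSimilar c u) : ∃ C : ℝ, HasTypeIDecay C u := by
  have hc0 : 0 < c := one_pos.trans hc
  have hq0 : 0 < q := by linarith
  have hq1 : (1 : ℝ≥0∞) ≤ ENNReal.ofReal q := by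
    rw [← ENNReal.ofReal_one]; exact ENNReal.ofReal_le_ofReal (by linarith)
  have hucont : ContinuousOn (uncurry u) (Iio 0 ×ˢ univ) := hsol.smooth_velocity.continuousOn
  -- ## Step 1: the rate `‖u(t)‖_q ≤ K₀ (−t)^{−κ}`, `κ = (q−3)/(2q)`
  obtain ⟨N, hN⟩ := exists_eLpNorm_le_on_strip hq1 hLq hcont (a := -c ^ 2) (b := -1) (by norm_num)
  set κ : ℝ := (q - 3) / (2 * q) with hκ
  have hκ0 : 0 ≤ κ := by rw [hκ]; positivity
  have hκ3 : 3 * κ < 1 := by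
    rw [hκ, ← sub_pos]; field_simp; nlinarith
  set K₀ : ℝ := c ^ (1 - 3 / q) * N with hK₀
  have hK₀0 : 0 ≤ K₀ := by positivity
  -- ## Step 3: the weighted Serrin integral on the annulus of `c²`
  have hc2 : 1 < c ^ 2 := by nlinarith
  have hdss2 : IsDiscretelySelfSimilar (c ^ 2) u := by
    have := hdss.zpow hc0.ne' 2
    rwa [zpow_ofNat] at this
  set D : Set (EuclideanSpace ℝ (Fin 3)) := {x | 1 ≤ ‖x‖ ∧ ‖x‖ < c ^ 2} with hD
  have hDm : MeasurableSet D :=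
    (isClosed_le continuous_const continuous_norm).measurableSet.inter
      (isOpen_lt continuous_norm continuous_const).measurableSet
  obtain ⟨N₂, hN₂⟩ := exists_eLpNorm_le_on_strip hq1 hLq hcont (a := -(c ^ 2) ^ 2) (b := -1) (by norm_num)
  have hfin : ∫⁻ z in Iio (0 : ℝ) ×ˢ D, ‖u z.1 z.2‖ₑ ^ q * ENNReal.ofReal ((-z.1) ^ ((q - 5) / 2)) < ⊤ := by
    refine lt_of_le_of_lt (lintegral_weighted_annulus_le hc2 hdss2 hq0) ?_
    refine ENNReal.mul_lt_top ENNReal.ofReal_lt_top ?_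
    exact lintegral_strip_lt_top hucont hq0 (by norm_num) hN₂
  -- ## the annulus of top points: `a = √c`, `[a, ca] ⊆ (1, c²)`
  set a : ℝ := Real.sqrt c with ha
  have ha1 : 1 < a := by rw [ha]; exact Real.lt_sqrt_of_sq_lt (by simpa using hc)
  have hac : c * a < c ^ 2 := by
    have : a < c := by
      rw [ha, Real.sqrt_lt' hc0]; nlinarith
    nlinarith
  set ρ : ℝ := min (a - 1) (c ^ 2 - c * a) / 2 with hρ
  have hρ0 : 0 < ρ := by rw [hρ]; exact half_pos (lt_min (by linarith) (by linarith))
  have hρa : ρ < a - 1 := by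
    rw [hρ]; linarith [min_le_left (a - 1) (c ^ 2 - c * a), lt_min (by linarith : (0:ℝ) < a - 1) (by linarith : (0:ℝ) < c ^ 2 - c * a)]
  have hρc : ρ < c ^ 2 - c * a := by
    rw [hρ]; linarith [min_le_right (a - 1) (c ^ 2 - c * a), lt_min (by linarith : (0:ℝ) < a - 1) (by linarith : (0:ℝ) < c ^ 2 - c * a)]
  have hballD : ∀ x₀ : EuclideanSpace ℝ (Fin 3), a ≤ ‖x₀‖ → ‖x₀‖ ≤ c * a → ball x₀ ρ ⊆ D := by
    intro x₀ h1 h2 y hy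
    rw [mem_ball, dist_eq_norm] at hy
    have hlow : ‖x₀‖ - ‖y - x₀‖ ≤ ‖y‖ := by
      have := norm_sub_norm_le x₀ (x₀ - y)
      rw [sub_sub_cancel, norm_sub_rev] at this
      linarith [abs_norm_sub_norm_le x₀ y, norm_sub_rev x₀ y]
    have hup : ‖y‖ ≤ ‖x₀‖ + ‖y - x₀‖ := by
      have := norm_add_le x₀ (y - x₀); rwa [add_sub_cancel] at this
    exact ⟨by linarith, by linarith⟩
  -- ## Steps 2 and 4 at each top point, Step 5
  set T : ℝ := ρ ^ 2 + 1 with hT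
  have hρT : ρ ^ 2 < T := by rw [hT]; linarith
  -- Step 1 gives the rate for every `t < 0`
  have hrate' : ∀ t ∈ Ioo (-T) 0,
      eLpNorm (u t) (ENNReal.ofReal q) volume ≤ ENNReal.ofReal (K₀ * (-t) ^ (-κ)) := by
    intro t ht
    have key := eLpNorm_le_of_dss_of_strip_bound hc hdss (p := ENNReal.ofReal q)
      (by rw [← ENNReal.ofReal_ofNat 3]; exact ENNReal.ofReal_le_ofReal hq3.le) ENNReal.ofReal_ne_top
      (N := N) hN ht.2
    rw [ENNReal.toReal_ofReal hq0.le] at key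
    refine key.trans (le_of_eq ?_)
    have hnt : 0 < -t := by linarith [ht.2]
    have hA : 0 ≤ c ^ (1 - 3 / q) * (-t) ^ ((3 / q - 1) / 2) :=
      mul_nonneg (Real.rpow_nonneg hc0.le _) (Real.rpow_nonneg hnt.le _)
    have e : (3 / q - 1) / 2 = -κ := by rw [hκ]; field_simp; ring
    rw [← ENNReal.ofReal_coe_nnreal, ← ENNReal.ofReal_mul hA, hK₀, e]
    congr 1; ring
  have hLq' : ∀ t ∈ Ioo (-T) 0, MemLp (u t) (ENNReal.ofReal q) volume := fun t ht => hLq t ht.2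
  refine hsol.exists_hasTypeIDecay_of_local_bounds hc hdss (a := a) (by linarith) fun x₀ hx1 hx2 => ?_
  -- Step 2: energy and pressure classes on `Q_ρ(0, x₀)`
  obtain ⟨⟨CE, hCE⟩, hG⟩ := hsol.exists_energy_classes_of_rate hq3.le hκ0 hκ3 hK₀0 hLq' hrate' x₀ hρ0 hρT
  obtain ⟨m, -, hreg, hpm⟩ := hsol.exists_pressure_class_of_rate hq3.le hκ0 hκ3 hK₀0 hLq' hrate' x₀ hρ0 hρT
  -- Step 4: `C(r) → 0`
  have hlim := tendsto_cknC_zero_of_weighted_lt_top hucont hDm hq3 hq9 hfin x₀ hρ0 (hballD x₀ hx1 hx2)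
  -- [gus]: regularity at the top point
  exact exists_bound_near_top_of_classical_Iio hsol x₀ hρ0 hreg hCE hG hpm hlim

end ChaeWolfDecay

/-- **Chae–Wolf 2017, Theorem 1.1, in the range `3 ≤ q < 9`: the instance `3 ≤ q < 9` of the body
of the named fact `chaeWolf2017_dss_typeI_decay`** (same binders). For `q ∈ [3, 9)` and `c > 1`,
every classical solution `(u, p)` of the unforced Navier–Stokes equations with viscosity `1` on
`(−∞, 0)` with slices in `C((−∞,0); L^q(ℝ³))` which is `c`-DSS obeys the Type I bound
`‖u(t,x)‖ ≤ C/(‖x‖ + √(−t))` for some `C` ((1.5)). The case `q = 3` is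
`chaeWolf2017_dss_typeI_decay_three`; for `3 < q < 9` the printed Steps 1–5 with the ε-regularity
theory up to the top in place of Wolf's criterion (see the module docstring). [cite: ChaeWolf2017RemovingDSS, Theorem 1.1 with (1.5), range 3 ≤ p < 9 (arXiv p. 3)] -/
theorem chaeWolf2017_dss_typeI_decay_of_lt_nine :
    ∀ q : ℝ, 3 ≤ q → q < 9 → ∀ c : ℝ, 1 < c →
    ∀ (u : ℝ → EuclideanSpace ℝ (Fin 3) → EuclideanSpace ℝ (Fin 3))
      (p : ℝ → EuclideanSpace ℝ (Fin 3) → ℝ), IsClassicalNSSolutionOn (Iio 0) 1 0 u p →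
      (∀ t < 0, MemLp (u t) (ENNReal.ofReal q) volume) →
      (∀ t₀ < 0, Filter.Tendsto (fun t => eLpNorm (u t - u t₀) (ENNReal.ofReal q) volume)
        (nhdsWithin t₀ (Iio 0)) (nhds 0)) →
      IsDiscretelySelfSimilar c u → ∃ C : ℝ, HasTypeIDecay C u := by
  intro q hq3 hq9 c hc u p hsol hLq hcont hdss
  rcases eq_or_lt_of_le hq3 with h3 | h3
  · subst h3
    exact chaeWolf2017_dss_typeI_decay_three c hc u p hsol hLq hcont hdss
  · exact ChaeWolfDecay.exists_hasTypeIDecay_of_memLp_of_lt_nine hc h3 hq9 hsol hLq hcont hdss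

end Literature.Analysis.FluidPDE

end
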